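import Mathlib.Algebra.Polynomial.Laurent
import Literature.Computability.AlgebraicComplexity.BLMW11FormulasWeaklySkew
import Literature.Computability.AlgebraicComplexity.BLMW11KroneckerApproximation
import Literature.Computability.AlgebraicComplexity.DDS21UABPWeaklySkew
import Literature.Computability.AlgebraicComplexity.ValiantConjectureEquivProofs
import HarnessLib

/-!
# Grochow–Mulmuley–Qiao 2016, *Boundaries of VP and VNP*: p-definable one-parameter
# degenerations (§3.3), the classes `𝒞*`, and `VP* ⊆ VNP`

Source: J. A. Grochow, K. D. Mulmuley, Y. Qiao, *Boundaries of VP and VNP*, ICALP 2016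
(LIPIcs 55, Art. 34), arXiv:1605.02815 [GrochowMulmuleyQiao2016].  Throughout the source the base
field is algebraically closed (§2).

## What is typed (statements only; named facts are `def … : Prop`, never asserted)

* §3.3, Definition (one-parameter degeneration): `f(x_1..x_m) = lim_{t→0} g(y_1(t), …, y_l(t))`
  where `y_i = a^i_0 + Σ_j a^i_j x_j` and each `a^i_j = Σ_{k=-K}^{K} c(i,j,k) t^k` is a Laurent
  polynomial of degree at most `K` — `substForm`, `degenerate`, `IsLimit`, `HasDegreeLE`,
  `IsDegenerationOfDegree` ("of exponential degree": `K(n) = O(2^{poly(n)})`, `IsExpBounded`; "of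
  polynomial degree": `K(n) = poly(n)`).
* §3.3, Definition (p-definable one-parameter degeneration): the coefficient table
  `(i, j, k) ↦ c(i,j,k)` is computed, on the binary encodings of `i`, `j`, `k`, by ONE arithmetic
  circuit of polynomial size with `0/1` inputs — `tripleBits`, `boolPt`, `IsPDefinable`,
  `IsPDefinableDegeneration`, `IsPDefinableDegenerationOf` (families), and the classes
  `𝒞*` for `𝒞 ∈ {VP, VP_ws, VNP}`: `IsVPStarFamily`, `IsVPwsStarFamily`, `IsVNPStarFamily`.
  Typing notes (both immaterial up to the polynomial-size circuit in the definition, and recorded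
  here rather than hidden): (i) the source indexes the affine slot by `0 ≤ j ≤ m` with `j = 0` the
  constant term; we index slots by `Option (Fin m)` and ENCODE `some j ↦ j`, `none ↦ m`
  (`slotCode`) — a relabelling computable by a linear-size Boolean circuit; (ii) the exponent
  `k ∈ [-K, K]` is encoded as the natural number `k + K`; (iii) the three integers are written in
  binary in three blocks of a common width `B` (`Fin 3 × Fin B`), the source uses blocks of widths
  `⌈log₂ l⌉, ⌈log₂ (m+1)⌉, ⌈log₂ (K+1)⌉`.
* Named facts (D-0014), stated over `ℂ`: `thm_1a_star` (`VNP* = VNP`, Thm. 1(a); content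
  `VNP* ⊆ VNP`), `lemma_4_3` (polynomial-degree degenerations of `VP` stay in `VP`), `prop_3_5`
  (`VP* ⊆ \overline{VP}`), and the OPEN QUESTIONS 4.4(3) `VP = VP*?` and 4.4(4)
  `VP* = \overline{VP}?` typed neutrally (`question_4_4_3`, `question_4_4_4`; (1)–(2) concern the
  stable / Newton degenerations `sVP`, `nVP`, not typed here).  Cor. 4.2 (`VP* ⊆ VNP`) and its
  `VP_ws` analogue (§1.1: "An analogue of this result also holds for VP_ws") are PROVED consequences
  of `thm_1a_star` (`cor_4_2_of_thm_1a_star`, `cor_4_2_ws_of_thm_1a_star`), not separate facts.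
* Proved sanity (our proofs of trivial inclusions of the source's chain
  `VP ⊆ sVP ⊆ nVP ⊆ VP* ⊆ \overline{VP}`, §1.1): `isPDefinableDegenerationOf_self` (every family with
  p-bounded variable sets is a p-definable degeneration of itself: identity substitution, `K = 0`,
  the equality-test circuit `eqCircuit`), hence `VP ⊆ VP*`, `VP_ws ⊆ VP_ws*`, `VNP ⊆ VNP*`
  (`isVPStarFamily_of_isVPFamily`, …) and `VP_ws* ⊆ VP*` (`isVPStarFamily_of_isVPwsStarFamily`).

Nothing in this file bears on `VP` versus `VNP`; census: named facts +5 (all `def`), `sorry` 0.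

References: [GrochowMulmuleyQiao2016] §1.1 Thm. 1, §3.3, Prop. 3.5, §4 Cor. 4.2, Lemma 4.3,
Question 4.4 (arXiv numbering); [Burgisser2004] (the `2^{poly}` degree bound behind "\overline{VP} =
one-parameter degenerations of VP of exponential degree", quoted in §3.3); [BurgisserEtAl2011] §9.4.
-/

noncomputable section

namespace Literature.Computability.AlgebraicComplexity

namespace GMQ2016

open MvPolynomial
open scoped LaurentPolynomial

variable {F : Type*} [CommRing F]

/-! ### §3.3 — one-parameter degenerations -/

/-- The affine forms `y_i = a^i_0 + Σ_{j=1}^{m} a^i_j x_j` of a one-parameter degeneration, with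
Laurent-polynomial coefficients `a i none = a^i_0`, `a i (some j) = a^i_j ∈ F[t, t⁻¹]`.
[cite: GrochowMulmuleyQiao2016, §3.3] -/
def substForm {l m : ℕ} (a : Fin l → Option (Fin m) → F[T;T⁻¹]) (i : Fin l) :
    MvPolynomial (Fin m) F[T;T⁻¹] :=
  C (a i none) + ∑ j : Fin m, C (a i (some j)) * X j

/-- `g(t) := g(y_1(t), …, y_l(t)) ∈ F[t,t⁻¹][x_1, …, x_m]`. [cite: GrochowMulmuleyQiao2016, §3.3] -/
def degenerate {l m : ℕ} (g : MvPolynomial (Fin l) F) (a : Fin l → Option (Fin m) → F[T;T⁻¹]) :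
    MvPolynomial (Fin m) F[T;T⁻¹] :=
  aeval (substForm a) g

/-- `f = lim_{t → 0} g(t)`: every coefficient of `g(t)` (a Laurent polynomial in `t`) has no pole at
`t = 0` and its constant term is the corresponding coefficient of `f`.
[cite: GrochowMulmuleyQiao2016, §3.3] -/
def IsLimit {m : ℕ} (f : MvPolynomial (Fin m) F) (G : MvPolynomial (Fin m) F[T;T⁻¹]) : Prop :=
  ∀ μ : Fin m →₀ ℕ, (∀ z : ℤ, z < 0 → (coeff μ G).coeff z = 0) ∧ (coeff μ G).coeff 0 = coeff μ f

/-- Degree bound: every `a^i_j = Σ_{k=-K}^{K} c(i,j,k) t^k` is supported on `[-K, K]`.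
[cite: GrochowMulmuleyQiao2016, §3.3] -/
def HasDegreeLE {l m : ℕ} (K : ℕ) (a : Fin l → Option (Fin m) → F[T;T⁻¹]) : Prop :=
  ∀ (i : Fin l) (j : Option (Fin m)) (z : ℤ), K < z.natAbs → (a i j).coeff z = 0

/-- `f` is a one-parameter degeneration of `g` of degree at most `K` ("of exponential degree" when
`K(n) = O(2^{poly(n)})`, "of polynomial degree" when `K(n) = poly(n)`).
[cite: GrochowMulmuleyQiao2016, §3.3] -/
def IsDegenerationOfDegree {l m : ℕ} (K : ℕ) (g : MvPolynomial (Fin l) F)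
    (f : MvPolynomial (Fin m) F) : Prop :=
  ∃ a : Fin l → Option (Fin m) → F[T;T⁻¹], HasDegreeLE K a ∧ IsLimit f (degenerate g a)

/-! ### §3.3 — p-definability of the coefficient table -/

/-- The `0/1` point of `F^ι` encoded by a bit pattern `e`. [cite: GrochowMulmuleyQiao2016, §3.3] -/
def boolPt {ι : Type*} (e : ι → Bool) : ι → F := fun p => if e p then 1 else 0

/-- The three integers `(i, j, κ)` in binary, block `p.1 ∈ Fin 3` selecting the integer and
`p.2 ∈ Fin B` the bit. [cite: GrochowMulmuleyQiao2016, §3.3] -/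
def tripleBits (B i j κ : ℕ) : Fin 3 × Fin B → Bool := fun p => (![i, j, κ] p.1).testBit p.2.val

/-- Code of an affine slot: variable slot `some j ↦ j`, constant slot `none ↦ m` (typing note (i)).
[cite: GrochowMulmuleyQiao2016, §3.3] -/
def slotCode {m : ℕ} (j : Option (Fin m)) : ℕ := j.elim m Fin.val

/-- The coefficient table `(i, j, k) ↦ c(i,j,k)` (`|k| ≤ K`, encoded `κ = k + K`) of the substitution
`a` is computed at the `0/1` encodings by one arithmetic circuit `Γ` over `F` of size at most `s`.
[cite: GrochowMulmuleyQiao2016, §3.3] -/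
def IsPDefinable {l m : ℕ} (K s : ℕ) (a : Fin l → Option (Fin m) → F[T;T⁻¹]) : Prop :=
  ∃ (B : ℕ) (Γ : MvPolynomial (Fin 3 × Fin B) F), complexity Γ ≤ s ∧
    ∀ (i : Fin l) (j : Option (Fin m)) (z : ℤ), z.natAbs ≤ K →
      (a i j).coeff z = eval (boolPt (tripleBits B i.val (slotCode j) (z + K).toNat)) Γ

/-- `f` is a p-definable one-parameter degeneration of `g` with degree budget `K` and circuit
budget `s`. [cite: GrochowMulmuleyQiao2016, §3.3] -/
def IsPDefinableDegeneration {l m : ℕ} (K s : ℕ) (g : MvPolynomial (Fin l) F)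
    (f : MvPolynomial (Fin m) F) : Prop :=
  ∃ a : Fin l → Option (Fin m) → F[T;T⁻¹],
    HasDegreeLE K a ∧ IsPDefinable K s a ∧ IsLimit f (degenerate g a)

/-- A p-definable degeneration is in particular a degeneration of the same degree.
[cite: GrochowMulmuleyQiao2016, §3.3] -/
theorem IsPDefinableDegeneration.isDegenerationOfDegree {l m K s : ℕ} {g : MvPolynomial (Fin l) F}
    {f : MvPolynomial (Fin m) F} (h : IsPDefinableDegeneration K s g f) :
    IsDegenerationOfDegree K g f := by
  obtain ⟨a, hK, -, hlim⟩ := h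
  exact ⟨a, hK, hlim⟩

/-! ### Families and the classes `𝒞*` -/

/-- `K(n) = O(2^{poly(n)})` (single-constant form `K n ≤ 2 ^ (n ^ c + c)`).
[cite: GrochowMulmuleyQiao2016, §3.3] -/
def IsExpBounded (K : ℕ → ℕ) : Prop :=
  ∃ c : ℕ, ∀ n, K n ≤ 2 ^ (n ^ c + c)

/-- The family `f = (f_n(x_1..x_{v n}))`, `v n = poly(n)`, is a p-definable one-parameter
degeneration of the family `g = (g_n(y_1..y_{l n}))`, `l n = poly(n)`: for some
`K(n) = O(2^{poly(n)})` and a `poly(n)`-size circuit family, each `f_n` is a p-definable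
degeneration of `g_n` within these budgets. [cite: GrochowMulmuleyQiao2016, §3.3] -/
def IsPDefinableDegenerationOf {l v : ℕ → ℕ} (g : ∀ n, MvPolynomial (Fin (l n)) F)
    (f : ∀ n, MvPolynomial (Fin (v n)) F) : Prop :=
  IsPBounded l ∧ IsPBounded v ∧ ∃ (K s : ℕ → ℕ), IsExpBounded K ∧ IsPBounded s ∧
    ∀ n, IsPDefinableDegeneration (K n) (s n) (g n) (f n)

/-- `VP*`: the p-definable one-parameter degenerations of `VP` families.
[cite: GrochowMulmuleyQiao2016, §3.3] -/
def IsVPStarFamily {v : ℕ → ℕ} (f : ∀ n, MvPolynomial (Fin (v n)) F) : Prop :=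
  ∃ (l : ℕ → ℕ) (g : ∀ n, MvPolynomial (Fin (l n)) F), IsVPFamily g ∧ IsPDefinableDegenerationOf g f

/-- `VP_ws*`: the p-definable one-parameter degenerations of `VP_ws` families (the source's "analogue
for VP_ws", §1.1). [cite: GrochowMulmuleyQiao2016, §1.1 and §3.3] -/
def IsVPwsStarFamily {v : ℕ → ℕ} (f : ∀ n, MvPolynomial (Fin (v n)) F) : Prop :=
  ∃ (l : ℕ → ℕ) (g : ∀ n, MvPolynomial (Fin (l n)) F),
    IsVPwsFamily g ∧ IsPDefinableDegenerationOf g f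

/-- `VNP*`: the p-definable one-parameter degenerations of `VNP` families.
[cite: GrochowMulmuleyQiao2016, §3.3] -/
def IsVNPStarFamily {v : ℕ → ℕ} (f : ∀ n, MvPolynomial (Fin (v n)) F) : Prop :=
  ∃ (l : ℕ → ℕ) (g : ∀ n, MvPolynomial (Fin (l n)) F),
    IsVNPFamily g ∧ IsPDefinableDegenerationOf g f

/-! ### Named facts (stated over `ℂ`; D-0014, never asserted here) -/

/-- **GMQ16 Thm. 1(a), the `VNP*` part: `VNP* = VNP`** (the inclusion `VNP ⊆ VNP*` is the trivial
`isVNPStarFamily_of_isVNPFamily` below; the content is `VNP* ⊆ VNP`, §4, proved via Valiant's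
criterion and the `VNP`-completeness of the permanent). [cite: GrochowMulmuleyQiao2016, Thm. 1(a)] -/
def thm_1a_star : Prop :=
  ∀ (v : ℕ → ℕ) (f : ∀ n, MvPolynomial (Fin (v n)) ℂ), IsVNPStarFamily f → IsVNPFamily f

/-- **GMQ16 Cor. 4.2: `VP* ⊆ VNP`** — here a CONSEQUENCE of `thm_1a_star` (`VP* ⊆ VNP* ⊆ VNP`,
the first inclusion being monotonicity of `𝒞 ↦ 𝒞*` along `VP ⊆ VNP`), so it is not registered as a
separate named fact. [cite: GrochowMulmuleyQiao2016, Cor. 4.2] -/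
theorem cor_4_2_of_thm_1a_star (h : thm_1a_star) (v : ℕ → ℕ) (f : ∀ n, MvPolynomial (Fin (v n)) ℂ)
    (hf : IsVPStarFamily f) : IsVNPFamily f := by
  obtain ⟨l, g, hg, hrest⟩ := hf
  exact h v f ⟨l, g, IsVPFamily.isVNPFamily_holds' hg, hrest⟩

/-- **GMQ16 Lemma 4.3** (Strassen / Bini interpolation; cf. Bürgisser 2004, Landsberg, Grochow):
"If `{f_n}` is a one-parameter degeneration of `{g_n} ∈ VP` of polynomial degree, then
`{f_n} ∈ VP`." [cite: GrochowMulmuleyQiao2016, Lemma 4.3] -/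
def lemma_4_3 : Prop :=
  ∀ (l v : ℕ → ℕ) (g : ∀ n, MvPolynomial (Fin (l n)) ℂ) (f : ∀ n, MvPolynomial (Fin (v n)) ℂ)
    (K : ℕ → ℕ), IsPBounded l → IsPBounded v → IsPBounded K → IsVPFamily g →
    (∀ n, IsDegenerationOfDegree (K n) (g n) (f n)) → IsVPFamily f

/-- **GMQ16 Prop. 3.5: `VP* ⊆ \overline{VP}`** ("immediate from the definitions" in the source's
operational definition of `\overline{VP}` via Laurent series; here `\overline{VP}` is the tree's
Zariski-closure rendering `IsVPBarFamily`, BLMW 2011 §9.3). [cite: GrochowMulmuleyQiao2016, Prop. 3.5] -/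
def prop_3_5 : Prop :=
  ∀ (v : ℕ → ℕ) (f : ∀ n, MvPolynomial (Fin (v n)) ℂ), IsVPStarFamily f → IsVPBarFamily f

/-- **GMQ16 Question 4.4(3) — OPEN QUESTION, typed neutrally, never asserted:** "Is `VP = VP*`?"
(the content is `VP* ⊆ VP`). [cite: GrochowMulmuleyQiao2016, Question 4.4(3)] [status: open question of the source] -/
def question_4_4_3 : Prop :=
  ∀ (v : ℕ → ℕ) (f : ∀ n, MvPolynomial (Fin (v n)) ℂ), IsVPStarFamily f → IsVPFamily f

/-- **GMQ16 Question 4.4(4) — OPEN QUESTION, typed neutrally, never asserted:** "Is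
`VP* = \overline{VP}`?" (the content is `\overline{VP} ⊆ VP*`, for families with p-bounded variable
sets; `\overline{VP}` = the tree's `IsVPBarFamily`). [cite: GrochowMulmuleyQiao2016, Question 4.4(4)] [status: open question of the source] -/
def question_4_4_4 : Prop :=
  ∀ (v : ℕ → ℕ) (f : ∀ n, MvPolynomial (Fin (v n)) ℂ), IsPBounded v →
    IsVPBarFamily f → IsVPStarFamily f

/-! ### Proved sanity: the identity degeneration, `𝒞 ⊆ 𝒞*`, `VP_ws* ⊆ VP*` -/

section Identity

variable (F)

/-- The identity substitution `y_i = x_i` (constant coefficients, no constant term).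
[cite: GrochowMulmuleyQiao2016, §1.1 (VP ⊆ VP*)] -/
def idSubst (m : ℕ) : Fin m → Option (Fin m) → F[T;T⁻¹] :=
  fun i j => if j = some i then 1 else 0

/-- One bit of the equality test: `x y + (1 - x)(1 - y)`. [folklore] -/
private def eqBit (B : ℕ) (b : Fin B) : MvPolynomial (Fin 3 × Fin B) F :=
  X ((0 : Fin 3), b) * X ((1 : Fin 3), b) + (1 - X ((0 : Fin 3), b)) * (1 - X ((1 : Fin 3), b))

/-- The equality-test circuit on the first two blocks: `Π_b (x_{0,b} x_{1,b} + (1-x_{0,b})(1-x_{1,b}))`.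
[folklore] -/
private def eqCircuit (B : ℕ) : MvPolynomial (Fin 3 × Fin B) F :=
  ∏ b : Fin B, eqBit F B b

variable {F}

/-- The identity substitution's forms are the variables. [folklore] -/
private theorem substForm_idSubst (m : ℕ) (i : Fin m) :
    substForm (idSubst F m) i = (X i : MvPolynomial (Fin m) F[T;T⁻¹]) := by
  classical
  simp only [substForm, idSubst]
  rw [Finset.sum_eq_single i (fun j _ hj => by simp [hj]) (by simp)]
  simp

/-- Degenerating along the identity substitution is the coefficient embedding `F ⊆ F[t,t⁻¹]`. [folklore] -/
private theorem degenerate_idSubst {m : ℕ} (g : MvPolynomial (Fin m) F) :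
    degenerate g (idSubst F m) = map (algebraMap F F[T;T⁻¹]) g := by
  unfold degenerate
  rw [show substForm (idSubst F m) = fun i => (X i : MvPolynomial (Fin m) F[T;T⁻¹]) from
    funext (substForm_idSubst m)]
  induction g using MvPolynomial.induction_on with
  | C a => simp
  | add p q hp hq => simp [hp, hq]
  | mul_X p i hp => simp [hp]

/-- Coefficients of a constant Laurent polynomial. [folklore] -/
private theorem coeff_laurentC (c : F) (z : ℤ) :
    (LaurentPolynomial.C c).coeff z = if z = 0 then c else 0 := by
  rw [← LaurentPolynomial.single_eq_C, AddMonoidAlgebra.coeff_single, Finsupp.single_apply]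
  simp [eq_comm]

/-- `g = lim_{t→0} g` along the identity substitution. [folklore] -/
private theorem isLimit_idSubst {m : ℕ} (g : MvPolynomial (Fin m) F) :
    IsLimit g (degenerate g (idSubst F m)) := by
  intro μ
  rw [degenerate_idSubst, coeff_map]
  refine ⟨fun z hz => ?_, ?_⟩
  · rw [show (algebraMap F F[T;T⁻¹]) (coeff μ g) = LaurentPolynomial.C (coeff μ g) from rfl,
      coeff_laurentC, if_neg hz.ne]
  · rw [show (algebraMap F F[T;T⁻¹]) (coeff μ g) = LaurentPolynomial.C (coeff μ g) from rfl,
      coeff_laurentC, if_pos rfl]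

/-- The identity substitution has degree `0 ≤ K`. [folklore] -/
private theorem hasDegreeLE_idSubst (m K : ℕ) : HasDegreeLE K (idSubst F m) := by
  intro i j z hz
  unfold idSubst
  split_ifs
  · rw [show (1 : F[T;T⁻¹]) = LaurentPolynomial.C 1 from (map_one _).symm, coeff_laurentC,
      if_neg (by rintro rfl; simp at hz)]
  · simp

/-- Value of one equality bit at a `0/1` point. [folklore] -/
private theorem eval_eqBit (B : ℕ) (b : Fin B) (e : Fin 3 × Fin B → Bool) :
    eval (boolPt e) (eqBit F B b) = if e (0, b) = e (1, b) then 1 else 0 := by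
  simp only [eqBit, map_add, map_mul, map_sub, map_one, eval_X, boolPt]
  cases e (0, b) <;> cases e (1, b) <;> simp

/-- Value of the equality circuit at a `0/1` point: `1` if the first two blocks agree, else `0`.
[folklore] -/
private theorem eval_eqCircuit (B : ℕ) (e : Fin 3 × Fin B → Bool) :
    eval (boolPt e) (eqCircuit F B) = if ∀ b : Fin B, e (0, b) = e (1, b) then 1 else 0 := by
  classical
  simp only [eqCircuit, map_prod, eval_eqBit]
  split_ifs with h
  · exact Finset.prod_eq_one fun b _ => by rw [if_pos (h b)]
  · obtain ⟨b, hb⟩ := not_forall.mp h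
    exact Finset.prod_eq_zero (Finset.mem_univ b) (by rw [if_neg hb])

/-- Two naturals below `2^B` with the same first `B` bits are equal. [folklore] -/
private theorem eq_of_testBit_eq_below {B i j : ℕ} (hi : i < 2 ^ B) (hj : j < 2 ^ B)
    (h : ∀ b : Fin B, i.testBit b.val = j.testBit b.val) : i = j := by
  refine Nat.eq_of_testBit_eq fun b => ?_
  by_cases hb : b < B
  · exact h ⟨b, hb⟩
  · have hb : B ≤ b := Nat.le_of_not_lt hb
    rw [Nat.testBit_lt_two_pow (lt_of_lt_of_le hi (Nat.pow_le_pow_right (by norm_num) hb)),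
      Nat.testBit_lt_two_pow (lt_of_lt_of_le hj (Nat.pow_le_pow_right (by norm_num) hb))]

/-- The equality circuit computes the identity substitution's table (width `B = m + 1`).
[folklore] -/
private theorem eval_eqCircuit_tripleBits {m : ℕ} (i : Fin m) (j : Option (Fin m)) (κ : ℕ) :
    eval (boolPt (tripleBits (m + 1) i.val (slotCode j) κ)) (eqCircuit F (m + 1)) =
      if j = some i then 1 else 0 := by
  rw [eval_eqCircuit]
  have h2 : m < 2 ^ (m + 1) := (Nat.lt_two_pow_self).trans (Nat.pow_lt_pow_right (by norm_num) (by omega))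
  have hi : i.val < 2 ^ (m + 1) := i.isLt.trans h2
  have hj : slotCode j < 2 ^ (m + 1) := by
    cases j with
    | none => exact h2
    | some j => exact j.isLt.trans h2
  have key : (∀ b : Fin (m + 1), tripleBits (m + 1) i.val (slotCode j) κ (0, b) =
      tripleBits (m + 1) i.val (slotCode j) κ (1, b)) ↔ j = some i := by
    simp only [tripleBits, Matrix.cons_val_zero, Matrix.cons_val_one]
    constructor
    · intro h
      have hij : i.val = slotCode j := eq_of_testBit_eq_below hi hj h
      cases j with
      | none => exact absurd hij (by simp [slotCode]; omega)
      | some j => exact congrArg some (Fin.ext hij.symm)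
    · rintro rfl
      intro b
      rfl
  simp only [key]

/-- The identity substitution's table (degree budget `0`) is computed by the equality circuit. [folklore] -/
private theorem isPDefinable_idSubst (m : ℕ) :
    IsPDefinable 0 (formulaComplexity (eqCircuit F (m + 1))) (idSubst F m) := by
  refine ⟨m + 1, eqCircuit F (m + 1), (complexity_le_wsComplexity_le_formulaComplexity _).1.trans
    (complexity_le_wsComplexity_le_formulaComplexity _).2, fun i j z hz => ?_⟩
  have hz0 : z = 0 := Int.natAbs_eq_zero.1 (Nat.le_zero.1 hz)
  subst hz0
  rw [eval_eqCircuit_tripleBits]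
  unfold idSubst
  split_ifs
  · rw [show (1 : F[T;T⁻¹]) = LaurentPolynomial.C 1 from (map_one _).symm, coeff_laurentC, if_pos rfl]
  · simp

/-- Size of the equality circuit: `E(eqCircuit B) ≤ 8 (B + 1)`. [folklore] -/
private theorem formulaComplexity_eqCircuit_le (B : ℕ) :
    formulaComplexity (eqCircuit F B) ≤ 8 * (B + 1) := by
  classical
  have hX : ∀ p : Fin 3 × Fin B, formulaComplexity (X p : MvPolynomial (Fin 3 × Fin B) F) ≤ 0 :=
    fun p => UABPWs.formulaComplexity_X_le p
  have hsub : ∀ p : Fin 3 × Fin B,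
      formulaComplexity (1 - X p : MvPolynomial (Fin 3 × Fin B) F) ≤ 2 := fun p => by
    have h1 : (1 - X p : MvPolynomial (Fin 3 × Fin B) F) = C 1 + C (-1) * X p := by
      rw [C_1, C_neg, C_1, neg_one_mul, sub_eq_add_neg]
    rw [h1]
    have := formulaComplexity_add_le (C 1 : MvPolynomial (Fin 3 × Fin B) F) (C (-1) * X p)
    have := formulaComplexity_mul_le (C (-1) : MvPolynomial (Fin 3 × Fin B) F) (X p)
    have := UABPWs.formulaComplexity_C_le (σ := Fin 3 × Fin B) (1 : F)
    have := UABPWs.formulaComplexity_C_le (σ := Fin 3 × Fin B) (-1 : F)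
    have := hX p
    omega
  have hbit : ∀ b : Fin B, formulaComplexity (eqBit F B b) ≤ 7 := fun b => by
    unfold eqBit
    have h0 := hX ((0 : Fin 3), b)
    have h1 := hX ((1 : Fin 3), b)
    have hs0 := hsub ((0 : Fin 3), b)
    have hs1 := hsub ((1 : Fin 3), b)
    have hm0 := formulaComplexity_mul_le (X ((0 : Fin 3), b) : MvPolynomial (Fin 3 × Fin B) F)
      (X ((1 : Fin 3), b))
    have hm1 := formulaComplexity_mul_le (1 - X ((0 : Fin 3), b) : MvPolynomial (Fin 3 × Fin B) F)
      (1 - X ((1 : Fin 3), b))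
    have ha := formulaComplexity_add_le
      (X ((0 : Fin 3), b) * X ((1 : Fin 3), b) : MvPolynomial (Fin 3 × Fin B) F)
      ((1 - X ((0 : Fin 3), b)) * (1 - X ((1 : Fin 3), b)))
    omega
  refine (UABPWs.formulaComplexity_finset_prod_le _ _).trans ?_
  calc ∑ b : Fin B, (formulaComplexity (eqBit F B b) + 1) ≤ ∑ _b : Fin B, 8 :=
        Finset.sum_le_sum fun b _ => by have := hbit b; omega
    _ = 8 * B := by simp [mul_comm]
    _ ≤ 8 * (B + 1) := by omega

/-- **Every family with p-bounded variable sets is a p-definable one-parameter degeneration of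
itself** (identity substitution, degree `K = 0`, the equality-test circuit).
[cite: GrochowMulmuleyQiao2016, §1.1 (the chain VP ⊆ sVP ⊆ nVP ⊆ VP*)] -/
theorem isPDefinableDegenerationOf_self {v : ℕ → ℕ} (f : ∀ n, MvPolynomial (Fin (v n)) F)
    (hv : IsPBounded v) : IsPDefinableDegenerationOf f f := by
  refine ⟨hv, hv, fun _ => 0, fun n => 8 * (v n + 1 + 1), ⟨0, fun n => by simp⟩, ?_, fun n => ?_⟩
  · exact IsPBounded.mul_holds (IsPBounded.const 8)
      (IsPBounded.add_holds (IsPBounded.add_holds hv (IsPBounded.const 1)) (IsPBounded.const 1))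
  · refine ⟨idSubst F (v n), hasDegreeLE_idSubst (v n) 0, ?_, isLimit_idSubst (f n)⟩
    obtain ⟨B, Γ, hΓ, htab⟩ := isPDefinable_idSubst (F := F) (v n)
    exact ⟨B, Γ, hΓ.trans (formulaComplexity_eqCircuit_le (F := F) (v n + 1)), htab⟩

/-- `VP ⊆ VP*`. [cite: GrochowMulmuleyQiao2016, §1.1 and Thm. 1(b)] -/
theorem isVPStarFamily_of_isVPFamily {v : ℕ → ℕ} {f : ∀ n, MvPolynomial (Fin (v n)) F}
    (hv : IsPBounded v) (hf : IsVPFamily f) : IsVPStarFamily f :=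
  ⟨v, f, hf, isPDefinableDegenerationOf_self f hv⟩

/-- `VP_ws ⊆ VP_ws*`. [cite: GrochowMulmuleyQiao2016, §1.1] -/
theorem isVPwsStarFamily_of_isVPwsFamily {v : ℕ → ℕ} {f : ∀ n, MvPolynomial (Fin (v n)) F}
    (hv : IsPBounded v) (hf : IsVPwsFamily f) : IsVPwsStarFamily f :=
  ⟨v, f, hf, isPDefinableDegenerationOf_self f hv⟩

/-- `VNP ⊆ VNP*` (the trivial half of Thm. 1(a)'s `VNP* = VNP`). [cite: GrochowMulmuleyQiao2016, Thm. 1(a)] -/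
theorem isVNPStarFamily_of_isVNPFamily {v : ℕ → ℕ} {f : ∀ n, MvPolynomial (Fin (v n)) F}
    (hv : IsPBounded v) (hf : IsVNPFamily f) : IsVNPStarFamily f :=
  ⟨v, f, hf, isPDefinableDegenerationOf_self f hv⟩

end Identity

/-- `VP_ws* ⊆ VP*` (since `VP_ws ⊆ VP`, BLMW 2011 §9.1). [cite: GrochowMulmuleyQiao2016, §1.1] -/
theorem isVPStarFamily_of_isVPwsStarFamily {v : ℕ → ℕ} {f : ∀ n, MvPolynomial (Fin (v n)) F}
    (hf : IsVPwsStarFamily f) : IsVPStarFamily f := by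
  obtain ⟨l, g, hg, hl, hrest⟩ := hf
  exact ⟨l, g, hg.isVPFamily (by simpa only [Fintype.card_fin] using hl), hl, hrest⟩

/-- **GMQ16 Cor. 4.2, `VP_ws` analogue** (§1.1: "An analogue of this result also holds for
VP_ws"): `VP_ws* ⊆ VNP`, a consequence of `thm_1a_star` via `VP_ws* ⊆ VP* ⊆ VNP* ⊆ VNP`.
[cite: GrochowMulmuleyQiao2016, §1.1 and Cor. 4.2] -/
theorem cor_4_2_ws_of_thm_1a_star (h : thm_1a_star) (v : ℕ → ℕ)
    (f : ∀ n, MvPolynomial (Fin (v n)) ℂ) (hf : IsVPwsStarFamily f) : IsVNPFamily f :=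
  cor_4_2_of_thm_1a_star h v f (isVPStarFamily_of_isVPwsStarFamily hf)

end GMQ2016

end Literature.Computability.AlgebraicComplexity
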